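import Summits.Ventures.DiscreteObjects.Hadamard.Order4NegaCore
import Summits.Ventures.DiscreteObjects.Hadamard.InvolutionTypeII

/-!
# H(668): NO AUTOMORPHISM OF ORDER 4 HAS A FIXED-POINT-FREE SQUARE (kernel)

Framing: lottery ticket; floor = certified bounds/negative ranges.

Cell pub-namedobj (venture DiscreteObjects), target (H), hadamard gen 13; HANDOFF-H-g13 item 1.  Transfer from an arbitrary
signed automorphism `(π, κ, d, e)` of a Hadamard matrix of order `668` with `π⁴ = κ⁴ = 1`, `π², κ²` fixed-point-free and nega
cycle signs (`d i · d (π i) · d (π² i) · d (π³ i) = −1`, likewise for `e`) to the block normal form of `Order4NegaCore`: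
representatives `c` of the 4-cycles (`c` minimal in `{c, πc, π²c, π³c}` for an auxiliary linear order), the bijection
`(p, c) ↦ π^p c : Fin 4 × R ≃ ι` (`orbit4_bijective`), and the re-signing `δ (p, c) = ∏_{q<p} d (π^q c)` turn `H` into an
equivalent Hadamard matrix on `Fin 4 × R` carrying the standard automorphism `(σ, σ, d₀, d₀)`, which
`no_hadamard668_nega4_blockform` excludes.
* `no_hadamard668_nega4` — the exclusion for `(π, κ, d, e)` as above;
* **`no_hadamard668_aut_order4_sq_fpf`** — for ANY signed automorphism of an `H(668)` with `π⁴ = κ⁴ = 1`: `π²` and `κ²` cannot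
  both be fixed-point-free (by `hadamard668_fpf_involution_nega` the square would be nega, and then the above applies).
  Equivalently: the square of every automorphism of order `4` of an `H(668)` is an involution of TYPE I (`f ≡ 4 (mod 8)` fixed
  rows, `hadamard668_involution_census_final`).
Paper background (FAMILY-F12-G13 §2): the `ℚ(ζ₈)`-Hermitian discriminant / `668 ∉ N(ℚ(ζ₈)/ℚ(√2))`; the kernel proof is the
elementary `√2`-folding.  Ours; no `sorry`.
-/

namespace Summit.Ventures.DiscreteObjects.Hadamard

open Finset BigOperators Matrix

open Literature.Combinatorics.Designs.GoethalsSeidel (IsHadamardMatrix)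

section orbit
variable {ι : Type*} [LinearOrder ι]

/-- the minimum of four elements is one of them -/
lemma min4_cases (a b c d : ι) :
    min (min a b) (min c d) = a ∨ min (min a b) (min c d) = b ∨ min (min a b) (min c d) = c ∨
      min (min a b) (min c d) = d := by
  rcases min_choice (min a b) (min c d) with h | h <;> rw [h]
  · rcases min_choice a b with h' | h' <;> rw [h'] <;> simp
  · rcases min_choice c d with h' | h' <;> rw [h'] <;> simp

/-- the minimum of four elements is below each -/
lemma min4_le (a b c d : ι) :
    min (min a b) (min c d) ≤ a ∧ min (min a b) (min c d) ≤ b ∧ min (min a b) (min c d) ≤ c ∧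
      min (min a b) (min c d) ≤ d :=
  ⟨le_trans (min_le_left _ _) (min_le_left _ _), le_trans (min_le_left _ _) (min_le_right _ _),
    le_trans (min_le_right _ _) (min_le_left _ _), le_trans (min_le_right _ _) (min_le_right _ _)⟩

/-- cyclic invariance of the minimum of four -/
lemma min4_rotate (a b c d : ι) : min (min a b) (min c d) = min (min b c) (min d a) := by
  obtain ⟨h1, h2, h3, h4⟩ := min4_le a b c d
  obtain ⟨g1, g2, g3, g4⟩ := min4_le b c d a
  exact le_antisymm (le_min (le_min h2 h3) (le_min h4 h1)) (le_min (le_min g4 g1) (le_min g2 g3))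

variable (π : Equiv.Perm ι)

/-- the orbit minimum is `π`-invariant when `π⁴ = 1` -/
lemma orbitMin_apply (hπ4 : ∀ i, π (π (π (π i))) = i) (i : ι) :
    min (min (π i) (π (π i))) (min (π (π (π i))) (π (π (π (π i))))) =
      min (min i (π i)) (min (π (π i)) (π (π (π i)))) := by
  rw [hπ4, ← min4_rotate]

end orbit

section transfer
variable {ι : Type*} [Fintype ι] [DecidableEq ι]

omit [DecidableEq ι] in
/-- **Orbit structure of a permutation with `π⁴ = 1`, `π²` fixed-point-free** (ordered index type): with
`R = {c | c < π c, c < π² c, c < π³ c}` (the minima of the 4-cycles), the map `(p, c) ↦ π^p c` is a bijection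
`Fin 4 × R → ι` intertwining the shift with `π`. -/
theorem orbit4_bijective [LinearOrder ι] (π : Equiv.Perm ι) (hπ4 : ∀ i, π (π (π (π i))) = i) (hπ2 : ∀ i, π (π i) ≠ i) :
    Function.Bijective (fun x : Fin 4 × {c // c ∈ univ.filter (fun c => c < π c ∧ c < π (π c) ∧ c < π (π (π c)))} =>
      (π ^ (x.1 : ℕ)) x.2.1) := by
  have hπ1 : ∀ i, π i ≠ i := fun i h => hπ2 i (by rw [h, h])
  have hπ3 : ∀ i, π (π (π i)) ≠ i := by
    intro i h
    have := hπ4 i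
    rw [h] at this
    exact hπ1 i this
  -- orbit minimum
  set M : ι → ι := fun i => min (min i (π i)) (min (π (π i)) (π (π (π i)))) with hM
  have hMπ : ∀ i, M (π i) = M i := fun i => orbitMin_apply π hπ4 i
  have hMle : ∀ i, M i ≤ i ∧ M i ≤ π i ∧ M i ≤ π (π i) ∧ M i ≤ π (π (π i)) := fun i => min4_le _ _ _ _
  have hMmem : ∀ i, M i = i ∨ M i = π i ∨ M i = π (π i) ∨ M i = π (π (π i)) := fun i => min4_cases _ _ _ _
  have hMrep : ∀ c, c < π c ∧ c < π (π c) ∧ c < π (π (π c)) → M c = c := by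
    intro c hc
    rcases hMmem c with h | h | h | h
    · exact h
    · exact absurd (h ▸ (hMle c).1) (not_le.mpr hc.1)
    · exact absurd (h ▸ (hMle c).1) (not_le.mpr hc.2.1)
    · exact absurd (h ▸ (hMle c).1) (not_le.mpr hc.2.2)
  have hMfix : ∀ i, M (M i) = M i := by
    intro i
    rcases hMmem i with h | h | h | h <;> rw [h]
    · exact h
    · rw [hMπ]; exact h
    · rw [hMπ, hMπ]; exact h
    · rw [hMπ, hMπ, hMπ]; exact h
  have hMinR : ∀ i, M i < π (M i) ∧ M i < π (π (M i)) ∧ M i < π (π (π (M i))) := by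
    intro i
    have h := hMle (M i)
    rw [hMfix] at h
    exact ⟨lt_of_le_of_ne h.2.1 (Ne.symm (hπ1 _)), lt_of_le_of_ne h.2.2.1 (Ne.symm (hπ2 _)),
      lt_of_le_of_ne h.2.2.2 (Ne.symm (hπ3 _))⟩
  have p2 : ∀ i, (π ^ 2) i = π (π i) := fun i => by simp [pow_two]
  have p3 : ∀ i, (π ^ 3) i = π (π (π i)) := fun i => by simp [pow_succ]
  constructor
  · rintro ⟨p, c, hc⟩ ⟨p', c', hc'⟩ h
    simp only at h
    have hcR := (Finset.mem_filter.mp hc).2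
    have hc'R := (Finset.mem_filter.mp hc').2
    have hMpow : ∀ (q : Fin 4) (x : ι), M ((π ^ (q : ℕ)) x) = M x := by
      intro q x
      fin_cases q <;> simp [p2, p3, hMπ]
    have hcc : c = c' := by
      have h1 := hMpow p c
      rw [h, hMpow p' c', hMrep c hcR, hMrep c' hc'R] at h1
      exact h1.symm
    subst hcc
    have hp : p = p' := by
      fin_cases p <;> fin_cases p' <;> simp [p2, p3] at h ⊢
      all_goals first
        | exact absurd h (hπ1 c) | exact absurd h.symm (hπ1 c)
        | exact absurd h (hπ2 c) | exact absurd h.symm (hπ2 c)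
        | exact absurd h (hπ3 c) | exact absurd h.symm (hπ3 c)
    rw [hp]
  · intro i
    have hR : M i ∈ univ.filter (fun c => c < π c ∧ c < π (π c) ∧ c < π (π (π c))) :=
      Finset.mem_filter.mpr ⟨Finset.mem_univ _, hMinR i⟩
    rcases hMmem i with h | h | h | h
    · exact ⟨(0, ⟨M i, hR⟩), by show (π ^ 0) (M i) = i; rw [pow_zero, Equiv.Perm.one_apply, h]⟩
    · exact ⟨(3, ⟨M i, hR⟩), by show (π ^ 3) (M i) = i; rw [p3, h, hπ4]⟩
    · exact ⟨(2, ⟨M i, hR⟩), by show (π ^ 2) (M i) = i; rw [p2, h, hπ4]⟩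
    · exact ⟨(1, ⟨M i, hR⟩), by show (π ^ 1) (M i) = i; rw [pow_one, h, hπ4]⟩

/-- **No H(668) with a nega automorphism of permutation order 4 acting by 4-cycles** (ordered index type). -/
theorem no_hadamard668_nega4_ord [LinearOrder ι] {H : Matrix ι ι ℤ} (hH : IsHadamardMatrix H)
    (hι : Fintype.card ι = 668) {π κ : Equiv.Perm ι} {d e : ι → ℤ} (haut : IsSignedAut H π κ d e)
    (hπ4 : ∀ i, π (π (π (π i))) = i) (hκ4 : ∀ j, κ (κ (κ (κ j))) = j)
    (hπ2 : ∀ i, π (π i) ≠ i) (hκ2 : ∀ j, κ (κ j) ≠ j)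
    (hdneg : ∀ i, d i * d (π i) * d (π (π i)) * d (π (π (π i))) = -1)
    (heneg : ∀ j, e j * e (κ j) * e (κ (κ j)) * e (κ (κ (κ j))) = -1) : False := by
  have hd := haut.1
  have he := haut.2.1
  have hA := haut.2.2
  have pm_mul : ∀ {a b : ℤ}, (a = 1 ∨ a = -1) → (b = 1 ∨ b = -1) → (a * b = 1 ∨ a * b = -1) := by
    intro a b ha hb
    rcases ha with h | h <;> rcases hb with h' | h' <;> simp [h, h']
  -- the two orbit bijections
  set Rr := univ.filter (fun c => c < π c ∧ c < π (π c) ∧ c < π (π (π c))) with hRr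
  set Rc := univ.filter (fun c => c < κ c ∧ c < κ (κ c) ∧ c < κ (κ (κ c))) with hRc
  let φr : Fin 4 × {c // c ∈ Rr} → ι := fun x => (π ^ (x.1 : ℕ)) x.2.1
  let φc : Fin 4 × {c // c ∈ Rc} → ι := fun x => (κ ^ (x.1 : ℕ)) x.2.1
  have hbr : Function.Bijective φr := orbit4_bijective π hπ4 hπ2
  have hbc : Function.Bijective φc := orbit4_bijective κ hκ4 hκ2
  let eR : Fin 4 × {c // c ∈ Rr} ≃ ι := Equiv.ofBijective φr hbr
  let eC' : Fin 4 × {c // c ∈ Rc} ≃ ι := Equiv.ofBijective φc hbc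
  have hcardR : Fintype.card {c // c ∈ Rr} = 167 := by
    have h := Fintype.card_congr eR
    rw [Fintype.card_prod, Fintype.card_fin, hι] at h
    omega
  have hcardC : Fintype.card {c // c ∈ Rc} = Fintype.card {c // c ∈ Rr} := by
    have h := Fintype.card_congr eC'
    rw [Fintype.card_prod, Fintype.card_fin, hι] at h
    omega
  obtain ⟨g⟩ : Nonempty ({c // c ∈ Rr} ≃ {c // c ∈ Rc}) := Fintype.card_eq.mp hcardC.symm
  let eC : Fin 4 × {c // c ∈ Rr} ≃ ι := ((Equiv.refl (Fin 4)).prodCongr g).trans eC'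
  -- intertwining with the shift
  set σ : Equiv.Perm (Fin 4 × {c // c ∈ Rr}) := (finRotate 4).prodCongr (Equiv.refl _) with hσdef
  have hσ : ∀ x : Fin 4 × {c // c ∈ Rr}, σ x = (x.1 + 1, x.2) := by
    rintro ⟨p, c⟩
    rw [hσdef, Equiv.prodCongr_apply, Prod.map_apply]
    simp [finRotate_apply]
  have p2 : ∀ (τ : Equiv.Perm ι) i, (τ ^ 2) i = τ (τ i) := fun τ i => by simp [pow_two]
  have p3 : ∀ (τ : Equiv.Perm ι) i, (τ ^ 3) i = τ (τ (τ i)) := fun τ i => by simp [pow_succ]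
  have heR : ∀ x, eR (σ x) = π (eR x) := by
    rintro ⟨p, c⟩
    rw [hσ]
    show (π ^ ((p + 1 : Fin 4) : ℕ)) c.1 = π ((π ^ (p : ℕ)) c.1)
    fin_cases p <;> simp [p2, p3, hπ4]
  have heC : ∀ x, eC (σ x) = κ (eC x) := by
    rintro ⟨p, c⟩
    rw [hσ]
    show (κ ^ ((p + 1 : Fin 4) : ℕ)) (g c).1 = κ ((κ ^ (p : ℕ)) (g c).1)
    fin_cases p <;> simp [p2, p3, hκ4]
  have heR0 : ∀ p (c : {c // c ∈ Rr}), eR (p, c) = (π ^ (p : ℕ)) c.1 := fun p c => rfl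
  have heC0 : ∀ p (c : {c // c ∈ Rr}), eC (p, c) = (κ ^ (p : ℕ)) (g c).1 := fun p c => rfl
  -- re-signing
  set δ : Fin 4 × {c // c ∈ Rr} → ℤ := fun x =>
    if x.1 = 0 then 1 else if x.1 = 1 then d x.2.1 else if x.1 = 2 then d x.2.1 * d (π x.2.1)
      else d x.2.1 * d (π x.2.1) * d (π (π x.2.1)) with hδdef
  set ε : Fin 4 × {c // c ∈ Rr} → ℤ := fun x =>
    if x.1 = 0 then 1 else if x.1 = 1 then e (g x.2).1 else if x.1 = 2 then e (g x.2).1 * e (κ (g x.2).1)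
      else e (g x.2).1 * e (κ (g x.2).1) * e (κ (κ (g x.2).1)) with hεdef
  set d₀ : Fin 4 × {c // c ∈ Rr} → ℤ := fun x => if x.1 = 3 then -1 else 1 with hd₀def
  have hδpm : ∀ x, δ x = 1 ∨ δ x = -1 := by
    rintro ⟨p, c⟩
    fin_cases p <;> simp only [hδdef] <;> simp
    · exact hd _
    · exact pm_mul (hd _) (hd _)
    · exact pm_mul (pm_mul (hd _) (hd _)) (hd _)
  have hεpm : ∀ x, ε x = 1 ∨ ε x = -1 := by
    rintro ⟨p, c⟩
    fin_cases p <;> simp only [hεdef] <;> simp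
    · exact he _
    · exact pm_mul (he _) (he _)
    · exact pm_mul (pm_mul (he _) (he _)) (he _)
  have hδkey : ∀ x, δ (σ x) * d (eR x) = d₀ x * δ x := by
    rintro ⟨p, c⟩
    rw [hσ, heR0]
    fin_cases p <;> simp only [hδdef, hd₀def] <;> simp [p2, p3]
    · exact pm_mul_self (hd _)
    · have := pm_mul_self (hd (π c.1)); linear_combination (d c.1) * this
    · have := pm_mul_self (hd (π (π c.1))); linear_combination (d c.1 * d (π c.1)) * this
    · have h1 := hdneg c.1
      have h2 := pm_mul_self (hd c.1)
      have h3 := pm_mul_self (hd (π c.1))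
      have h4 := pm_mul_self (hd (π (π c.1)))
      rcases hd c.1 with a | a <;> rcases hd (π c.1) with b | b <;> rcases hd (π (π c.1)) with f | f <;>
        rcases hd (π (π (π c.1))) with k | k <;> simp [a, b, f, k] at h1 ⊢
  have hεkey : ∀ x, ε (σ x) * e (eC x) = d₀ x * ε x := by
    rintro ⟨p, c⟩
    rw [hσ, heC0]
    fin_cases p <;> simp only [hεdef, hd₀def] <;> simp [p2, p3]
    · exact pm_mul_self (he _)
    · have := pm_mul_self (he (κ (g c).1)); linear_combination (e (g c).1) * this
    · have := pm_mul_self (he (κ (κ (g c).1))); linear_combination (e (g c).1 * e (κ (g c).1)) * this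
    · have h1 := heneg (g c).1
      rcases he (g c).1 with a | a <;> rcases he (κ (g c).1) with b | b <;> rcases he (κ (κ (g c).1)) with f | f <;>
        rcases he (κ (κ (κ (g c).1))) with k | k <;> simp [a, b, f, k] at h1 ⊢
  -- the transported, re-signed matrix
  set H' : Matrix (Fin 4 × {c // c ∈ Rr}) (Fin 4 × {c // c ∈ Rr}) ℤ :=
    fun x y => δ x * ε y * H (eR x) (eC y) with hH'def
  have hH' : IsHadamardMatrix H' := by
    refine ⟨fun x y => ?_, ?_⟩
    · rw [hH'def]
      exact pm_mul (pm_mul (hδpm x) (hεpm y)) (hH.1 _ _)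
    · ext x x'
      rw [Matrix.mul_apply, Matrix.smul_apply, Matrix.one_apply]
      simp only [hH'def, transpose_apply, smul_eq_mul]
      have hcardι : (Fintype.card ι : ℤ) ≠ 0 := by rw [hι]; norm_num
      have e1 : ∑ y, δ x * ε y * H (eR x) (eC y) * (δ x' * ε y * H (eR x') (eC y))
          = δ x * δ x' * ∑ y, H (eR x) (eC y) * H (eR x') (eC y) := by
        rw [Finset.mul_sum]
        refine Finset.sum_congr rfl fun y _ => ?_
        have := pm_mul_self (hεpm y)
        linear_combination (δ x * δ x' * H (eR x) (eC y) * H (eR x') (eC y)) * this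
      rw [e1, Equiv.sum_comp eC (fun j => H (eR x) j * H (eR x') j)]
      rw [Fintype.card_congr eR]
      by_cases hxx : x = x'
      · subst hxx
        rw [hadamard_row_self H hH, if_pos rfl, pm_mul_self (hδpm x), one_mul, mul_one]
      · have hne : eR x ≠ eR x' := fun h => hxx (eR.injective h)
        rw [hadamard_row_orth H hH hne, if_neg hxx, mul_zero, mul_zero]
  have haut' : IsSignedAut H' σ σ d₀ d₀ := by
    refine ⟨fun x => ?_, fun x => ?_, fun x y => ?_⟩
    · simp only [hd₀def]; split_ifs <;> simp
    · simp only [hd₀def]; split_ifs <;> simp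
    · show δ (σ x) * ε (σ y) * H (eR (σ x)) (eC (σ y)) = d₀ x * d₀ y * (δ x * ε y * H (eR x) (eC y))
      rw [heR, heC, hA]
      have h1 := hδkey x
      have h2 := hεkey y
      linear_combination (ε (σ y) * e (eC y) * H (eR x) (eC y)) * h1 + (d₀ x * δ x * H (eR x) (eC y)) * h2
  exact no_hadamard668_nega4_blockform hcardR H' hH' haut'

/-- **No H(668) with a nega automorphism of permutation order 4 acting by 4-cycles.** -/
theorem no_hadamard668_nega4 {H : Matrix ι ι ℤ} (hH : IsHadamardMatrix H)
    (hι : Fintype.card ι = 668) {π κ : Equiv.Perm ι} {d e : ι → ℤ} (haut : IsSignedAut H π κ d e)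
    (hπ4 : ∀ i, π (π (π (π i))) = i) (hκ4 : ∀ j, κ (κ (κ (κ j))) = j)
    (hπ2 : ∀ i, π (π i) ≠ i) (hκ2 : ∀ j, κ (κ j) ≠ j)
    (hdneg : ∀ i, d i * d (π i) * d (π (π i)) * d (π (π (π i))) = -1)
    (heneg : ∀ j, e j * e (κ j) * e (κ (κ j)) * e (κ (κ (κ j))) = -1) : False := by
  classical
  letI : LinearOrder ι := LinearOrder.lift' (Fintype.equivFin ι) (Fintype.equivFin ι).injective
  exact no_hadamard668_nega4_ord hH hι haut hπ4 hκ4 hπ2 hκ2 hdneg heneg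

/-- **H(668): no automorphism of order 4 has a fixed-point-free square.**  For a signed automorphism `(π, κ, d, e)` of a
Hadamard matrix of order `668` with `π⁴ = κ⁴ = 1`, the squares `π²`, `κ²` are not both fixed-point-free.  (If they were,
`(π², κ², d·(d∘π), e·(e∘κ))` would be a fixed-point-free involution pair, hence NEGA by `hadamard668_fpf_involution_nega`,
and `no_hadamard668_nega4` applies.)  Equivalently: the square of an order-4 automorphism is of type I. -/
theorem no_hadamard668_aut_order4_sq_fpf {H : Matrix ι ι ℤ} (hH : IsHadamardMatrix H)
    (hι : Fintype.card ι = 668) {π κ : Equiv.Perm ι} {d e : ι → ℤ} (haut : IsSignedAut H π κ d e)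
    (hπ4 : ∀ i, π (π (π (π i))) = i) (hκ4 : ∀ j, κ (κ (κ (κ j))) = j)
    (hπ2 : ∀ i, π (π i) ≠ i) (hκ2 : ∀ j, κ (κ j) ≠ j) : False := by
  have hd := haut.1
  have he := haut.2.1
  have hA := haut.2.2
  have pm_mul : ∀ {a b : ℤ}, (a = 1 ∨ a = -1) → (b = 1 ∨ b = -1) → (a * b = 1 ∨ a * b = -1) := by
    intro a b ha hb
    rcases ha with h | h <;> rcases hb with h' | h' <;> simp [h, h']
  -- the square as a signed automorphism
  have haut2 : IsSignedAut H (π ^ 2) (κ ^ 2) (fun i => d i * d (π i)) (fun j => e j * e (κ j)) := by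
    refine ⟨fun i => pm_mul (hd i) (hd (π i)), fun j => pm_mul (he j) (he (κ j)), fun i j => ?_⟩
    have p2π : (π ^ 2) i = π (π i) := by simp [pow_two]
    have p2κ : (κ ^ 2) j = κ (κ j) := by simp [pow_two]
    rw [p2π, p2κ, hA, hA]
    ring
  have hπ2inv : ∀ i, (π ^ 2) ((π ^ 2) i) = i := fun i => by simp [pow_two, hπ4]
  have hκ2inv : ∀ j, (κ ^ 2) ((κ ^ 2) j) = j := fun j => by simp [pow_two, hκ4]
  have hπ2f : ∀ i, (π ^ 2) i ≠ i := fun i => by simp [pow_two, hπ2]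
  have hκ2f : ∀ j, (κ ^ 2) j ≠ j := fun j => by simp [pow_two, hκ2]
  obtain ⟨hrow, hcol⟩ := hadamard668_fpf_involution_nega hH hι haut2 hπ2inv hκ2inv hπ2f hκ2f
  have hdneg : ∀ i, d i * d (π i) * d (π (π i)) * d (π (π (π i))) = -1 := by
    intro i
    have h := hrow i
    simp only [pow_two, Equiv.Perm.mul_apply] at h
    have := pm_mul_self (pm_mul (hd i) (hd (π i)))
    linear_combination (d i * d (π i)) * h - this
  have heneg : ∀ j, e j * e (κ j) * e (κ (κ j)) * e (κ (κ (κ j))) = -1 := by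
    intro j
    have h := hcol j
    simp only [pow_two, Equiv.Perm.mul_apply] at h
    have := pm_mul_self (pm_mul (he j) (he (κ j)))
    linear_combination (e j * e (κ j)) * h - this
  exact no_hadamard668_nega4 hH hι haut hπ4 hκ4 hπ2 hκ2 hdneg heneg

end transfer

end Summit.Ventures.DiscreteObjects.Hadamard
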